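import Literature.AnabelianGeometry.EtaleTheta.TemperedRigidity
import Literature.AnabelianGeometry.EtaleTheta.ThetaLiftUnique
import HarnessLib

/-!
# [EtTh] Theorem 1.6 (ii)(iii): "the isomorphism of cohomology groups induced by γ" IS an isomorphism,
# and the reductions of (ii), (iii) to their printed inputs (sub-DAG `EtTh:Thm1.6`, part 3 — rows L11, L13, L14, L00(iii))

Mochizuki, *The étale theta function …*, Publ. RIMS **45** (2009), Thm. 1.6 (ii)(iii), PRIMS PDF
pp. 24–25 (printed 250–251) [cite: MochizukiEtTh2009, Thm 1.6 p.24]. abc-iut cell, layer L2, D-0068 (1)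
statements-first sub-DAG (index `plan/L2/SUBDAG-EtTh-Thm16.md`; seat abc-iut-L6-d5, §K row K3).
Companion of abc-iut-L2-t1's `TemperedRigidity.lean`, whose `ThetaSetting.transport c h :
H¹(Π^tp_{Ÿα}, (Δ_Θ)α) →* H¹(Π^tp_{Ÿβ}, (Δ_Θ)β)` ("the isomorphism of cohomology groups induced by γ",
p. 24) is typed as a homomorphism only.

PROVED here (pure group cohomology over the root interface, no new fact):
* `Thm16Sub.thm16i_symm`, `Thm16Sub.companionSymm` — Thm. 1.6 (i) and a theta companion for `γ` give
  the same for `γ⁻¹`;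
* `Thm16Sub.transport_symm_transport`, `transport_transport_symm`, `transportEquiv` — the transports
  along `(γ, c)` and `(γ⁻¹, c⁻¹)` are mutually inverse: the induced map on `H¹` IS an isomorphism
  (row L13's "tautology" level: transport is functorial in `γ`);
* `Thm16Sub.exists_delta_of_transportPreservesFdd2` — clause (a) of abc-iut-L2-t1's `Thm16ii` (the
  isomorphism `δ : (K̈α^×)^∧ ⥲ (K̈β^×)^∧` "induced by γ" on `F̈² ≅ (K̈^×)^∧`) EXISTS as soon as transport
  carries the image of the Kummer injection for `α` onto that for `β` (`TransportPreservesFdd2`, an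
  IMAGE statement — at genuine data it is Prop. 1.5 (ii) `F̈² = H¹(G_K̈, Δ_Θ)` + [SemiAnbd] Thm. 6.12);
  `thm16ii_of_inputs` — `Thm16ii` ⟸ `TransportPreservesFdd2` + the valuation clauses (b)(c) for the
  resulting `δ` (`DeltaPreservesUnitsAndOne`, = [AbsAnab] Prop. 1.2.1 (iv)(vi)(vii) at genuine data);
* `Thm16Sub.div_mem_Fdd1_of_res_eq` — row L14, filtration half: two classes of `H¹((Π^tp_Ÿ)^Θ, Δ_Θ)`
  with the same restriction to `Δ_Θ` ("mapping to log(Θ) in F̈⁰/F̈¹", p. 25) differ by an element of `F̈¹`;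
* `Thm16Sub.thm16iii_of_core` — row L00(iii): `Thm16iii` ⟸ {units transported to units, `Z`-conjugation
  stabilises the unit classes, the core identity `transport(η̈^Θ_α) ∈ κ(O^×_{K̈β})·conj_σ(η̈^Θ_β)`} (set
  algebra in `H¹`).
STATED only (`def … : Prop`, targets, never asserted): `TransportPreservesFdd2`, `DeltaPreservesUnitsAndOne`.
HONEST FRAMING: [EtTh] is refereed and undisputed; typed ≠ proved; no side taken on [IUTchIII] Cor. 3.12.
-/

noncomputable section

namespace Literature.AnabelianGeometry.EtaleTheta

open Literature.AnabelianGeometry.SemiGraphs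

namespace Thm16Sub

variable {p : ℕ} [Fact p.Prime] {Dα Dβ : ThetaSetting p} {γ : Dα.PiTemp ≃ₜ* Dβ.PiTemp}

/-! ### Thm. 1.6 (i) and theta companions for `γ⁻¹` -/

/-- Thm. 1.6 (i) for `γ` gives Thm. 1.6 (i) for `γ⁻¹`. [cite: MochizukiEtTh2009, Thm 1.6 (i) p.24] -/
theorem thm16i_symm (h : ThetaSetting.Thm16i γ) : ThetaSetting.Thm16i γ.symm := by
  change Dβ.GtpYdd.map γ.symm.toMulEquiv.toMonoidHom = Dα.GtpYdd
  rw [← h, Subgroup.map_map]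
  convert Subgroup.map_id _
  ext x
  exact γ.symm_apply_apply x

/-- A theta companion of `γ` yields one of `γ⁻¹` (inverse isomorphism of theta quotients).
[cite: MochizukiEtTh2009, Thm 1.6 (ii) p.24] -/
def companionSymm (c : ThetaSetting.ThetaCompanion γ) : ThetaSetting.ThetaCompanion γ.symm where
  thetaIso := c.thetaIso.symm
  comm y := by
    apply c.thetaIso.toMulEquiv.injective
    change c.thetaIso.toMulEquiv (Dα.toTheta (γ.toMulEquiv.symm y)) =
      c.thetaIso.toMulEquiv (c.thetaIso.toMulEquiv.symm (Dβ.toTheta y))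
    rw [MulEquiv.apply_symm_apply, ← c.comm, MulEquiv.apply_symm_apply]
  map_deltaTheta := by
    rw [← c.map_deltaTheta, Subgroup.map_map]
    convert Subgroup.map_id _
    ext x
    exact c.thetaIso.symm_apply_apply x

/-! ### The transports along `(γ, c)` and `(γ⁻¹, c⁻¹)` are mutually inverse -/

/-- On cocycles: transporting along `(γ, c)` and back is the identity.
[cite: MochizukiEtTh2009, Thm 1.6 (iii) p.24] -/
theorem transportFun_symm_transportFun (c : ThetaSetting.ThetaCompanion γ) (h : ThetaSetting.Thm16i γ)
    (f : Dα.GtpYdd → Dα.DeltaTheta) :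
    ThetaSetting.transportFun (companionSymm c) (thm16i_symm h) (ThetaSetting.transportFun c h f) = f := by
  funext x
  apply Subtype.ext
  change c.thetaIso.symm (c.thetaIso (f ⟨γ.toMulEquiv.symm (γ.symm.toMulEquiv.symm x.1), _⟩).1) = (f x).1
  rw [ContinuousMulEquiv.symm_apply_apply]
  congr 2
  apply Subtype.ext
  exact γ.symm_apply_apply x.1

/-- On cocycles: transporting along `(γ⁻¹, c⁻¹)` and then `(γ, c)` is the identity.
[cite: MochizukiEtTh2009, Thm 1.6 (iii) p.24] -/
theorem transportFun_transportFun_symm (c : ThetaSetting.ThetaCompanion γ) (h : ThetaSetting.Thm16i γ)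
    (g : Dβ.GtpYdd → Dβ.DeltaTheta) :
    ThetaSetting.transportFun c h (ThetaSetting.transportFun (companionSymm c) (thm16i_symm h) g) = g := by
  funext x
  apply Subtype.ext
  change c.thetaIso (c.thetaIso.symm (g ⟨γ.symm.toMulEquiv.symm (γ.toMulEquiv.symm x.1), _⟩).1) = (g x).1
  rw [ContinuousMulEquiv.apply_symm_apply]
  congr 2
  apply Subtype.ext
  exact γ.apply_symm_apply x.1

/-- **"The isomorphism of cohomology groups induced by γ"** (p. 24): transport back along `(γ⁻¹, c⁻¹)`
inverts abc-iut-L2-t1's `transport c h` on `H¹(Π^tp_Ÿ, Δ_Θ)`. [cite: MochizukiEtTh2009, Thm 1.6 (iii) p.24] -/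
theorem transport_symm_transport (c : ThetaSetting.ThetaCompanion γ) (h : ThetaSetting.Thm16i γ)
    (x : Dα.H1 Dα.GtpYdd) :
    ThetaSetting.transport (companionSymm c) (thm16i_symm h) (ThetaSetting.transport c h x) = x := by
  induction x using QuotientGroup.induction_on with
  | H f =>
    change QuotientGroup.mk (ThetaSetting.transportCocycle (companionSymm c) (thm16i_symm h)
      (ThetaSetting.transportCocycle c h f)) = QuotientGroup.mk f
    congr 1
    exact Subtype.ext (transportFun_symm_transportFun c h f.1)

/-- … and conversely. [cite: MochizukiEtTh2009, Thm 1.6 (iii) p.24] -/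
theorem transport_transport_symm (c : ThetaSetting.ThetaCompanion γ) (h : ThetaSetting.Thm16i γ)
    (y : Dβ.H1 Dβ.GtpYdd) :
    ThetaSetting.transport c h (ThetaSetting.transport (companionSymm c) (thm16i_symm h) y) = y := by
  induction y using QuotientGroup.induction_on with
  | H g =>
    change QuotientGroup.mk (ThetaSetting.transportCocycle c h
      (ThetaSetting.transportCocycle (companionSymm c) (thm16i_symm h) g)) = QuotientGroup.mk g
    congr 1
    exact Subtype.ext (transportFun_transportFun_symm c h g.1)

/-- `transport c h : H¹(Π^tp_{Ÿα}, (Δ_Θ)α) ⥲ H¹(Π^tp_{Ÿβ}, (Δ_Θ)β)` as an isomorphism of groups.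
[cite: MochizukiEtTh2009, Thm 1.6 (iii) p.24] -/
def transportEquiv (c : ThetaSetting.ThetaCompanion γ) (h : ThetaSetting.Thm16i γ) :
    Dα.H1 Dα.GtpYdd ≃* Dβ.H1 Dβ.GtpYdd :=
  MonoidHom.toMulEquiv (ThetaSetting.transport c h)
    (ThetaSetting.transport (companionSymm c) (thm16i_symm h))
    (MonoidHom.ext fun x => transport_symm_transport c h x)
    (MonoidHom.ext fun y => transport_transport_symm c h y)

/-- `transportEquiv` is `transport` on elements. [cite: MochizukiEtTh2009, Thm 1.6 (iii) p.24] -/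
@[simp] theorem transportEquiv_apply (c : ThetaSetting.ThetaCompanion γ) (h : ThetaSetting.Thm16i γ)
    (x : Dα.H1 Dα.GtpYdd) : transportEquiv c h x = ThetaSetting.transport c h x := rfl

/-- In particular `transport c h` is injective. [cite: MochizukiEtTh2009, Thm 1.6 (iii) p.24] -/
theorem transport_injective (c : ThetaSetting.ThetaCompanion γ) (h : ThetaSetting.Thm16i γ) :
    Function.Injective (ThetaSetting.transport c h) :=
  (transportEquiv c h).injective

/-! ### Row L11: Theorem 1.6 (ii) reduced to its two printed inputs -/

/-- The image `F̈² ≅ (K̈^×)^∧` of the Kummer injection inside `H¹(Π^tp_Ÿ, Δ_Θ)` (inflation of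
`kumYdd`; Prop. 1.5 (ii) `F̈² = H¹(G_K̈, Δ_Θ)`, p. 23). [cite: MochizukiEtTh2009, Prop 1.5 (ii) p.23] -/
def kumRange {D : ThetaSetting p} (E : D.KummerData) : Subgroup (D.H1 D.GtpYdd) :=
  ((D.inflTheta D.GtpYdd).comp E.kumYdd).range

/-- **L11 (a), as an IMAGE statement.** "γ induces an isomorphism H¹(G_{K̈α}, (Δ_Θ)α) ⥲ H¹(G_{K̈β}, (Δ_Θ)β)"
(p. 24): the transport along `(γ, c)` carries the `α`-Kummer image `F̈²_α` onto `F̈²_β`. At genuine data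
this is Prop. 1.5 (ii) (`F̈²` is intrinsic: the inflation of `H¹(G_K̈, Δ_Θ)`) with [SemiAnbd] Thm. 6.12
(the induced `Δ_Θ ≅ Ẑ(1)` identifications agree); over abc-iut-L2-t1's abstract `KummerData` it is a
statement about the data, never asserted. [cite: MochizukiEtTh2009, Thm 1.6 (ii) p.24] -/
def TransportPreservesFdd2 (c : ThetaSetting.ThetaCompanion γ) (h : ThetaSetting.Thm16i γ)
    (Eα : Dα.KummerData) (Eβ : Dβ.KummerData) : Prop :=
  (kumRange Eα).map (ThetaSetting.transport c h) = kumRange Eβ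

/-- The Kummer injection into `H¹(Π^tp_Ÿ, Δ_Θ)` is injective (`kumYdd_injective` and abc-iut-L2-t12's
`inflTheta_injective`). [cite: MochizukiEtTh2009, Prop 1.5 (ii) p.23] -/
theorem inflKum_injective {D : ThetaSetting p} (E : D.KummerData) :
    Function.Injective ((D.inflTheta D.GtpYdd).comp E.kumYdd) :=
  (D.inflTheta_injective D.GtpYdd).comp E.kumYdd_injective

/-- **L11 (a).** If transport carries `F̈²_α` onto `F̈²_β`, the isomorphism
`δ : (K̈α^×)^∧ ⥲ (K̈β^×)^∧` "induced by γ" EXISTS and is unique: `transport (κ a) = κ (δ a)`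
(clause (a) of `ThetaSetting.Thm16ii`). [cite: MochizukiEtTh2009, Thm 1.6 (ii) p.24] -/
theorem exists_delta_of_transportPreservesFdd2 (c : ThetaSetting.ThetaCompanion γ)
    (h : ThetaSetting.Thm16i γ) (Eα : Dα.KummerData) (Eβ : Dβ.KummerData)
    (hT : TransportPreservesFdd2 c h Eα Eβ) :
    ∃ δ : Eα.KddHat ≃* Eβ.KddHat, ∀ a : Eα.KddHat,
      ThetaSetting.transport c h (Dα.inflTheta Dα.GtpYdd (Eα.kumYdd a)) =
        Dβ.inflTheta Dβ.GtpYdd (Eβ.kumYdd (δ a)) := by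
  let ια := (Dα.inflTheta Dα.GtpYdd).comp Eα.kumYdd
  let ιβ := (Dβ.inflTheta Dβ.GtpYdd).comp Eβ.kumYdd
  let eα : Eα.KddHat ≃* ια.range := MonoidHom.ofInjective (inflKum_injective Eα)
  let eβ : Eβ.KddHat ≃* ιβ.range := MonoidHom.ofInjective (inflKum_injective Eβ)
  let eT : ια.range ≃* (ια.range).map (ThetaSetting.transport c h) :=
    Subgroup.equivMapOfInjective _ _ (transport_injective c h)
  let eEq : (ια.range).map (ThetaSetting.transport c h) ≃* ιβ.range := MulEquiv.subgroupCongr hT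
  refine ⟨eα.trans (eT.trans (eEq.trans eβ.symm)), fun a => ?_⟩
  have h1 : ((eT (eα a) : (ια.range).map (ThetaSetting.transport c h)) : Dβ.H1 Dβ.GtpYdd) =
      ThetaSetting.transport c h (ια a) := rfl
  have h2 : ∀ z : (ια.range).map (ThetaSetting.transport c h), ((eEq z : ιβ.range) : Dβ.H1 Dβ.GtpYdd) = z :=
    fun z => rfl
  have h3 : ∀ w : ιβ.range, ιβ (eβ.symm w) = w := fun w => by
    have := MonoidHom.apply_ofInjective_symm (inflKum_injective Eβ) w
    exact this
  change ThetaSetting.transport c h (ια a) = ιβ (eβ.symm (eEq (eT (eα a))))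
  rw [h3, h2, h1]

/-- **L11 (b)(c), for a given `δ`.** The valuation clauses of `ThetaSetting.Thm16ii`: `δ` preserves
the kernel `Ker((K̈^×)^∧ ↠ Ẑ)` and "the elements 1 ∈ Ẑ" (uniformizers modulo units) — at genuine data
[AbsAnab] Prop. 1.2.1 (iv), (vi), (vii); over the abstract `ValuationHatData` a statement about the
data, never asserted. [cite: MochizukiEtTh2009, Thm 1.6 (ii) p.24] -/
def DeltaPreservesUnitsAndOne {Eα : Dα.KummerData} {Eβ : Dβ.KummerData} (δ : Eα.KddHat ≃* Eβ.KddHat)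
    (Vα : ThetaSetting.ValuationHatData Dα Eα) (Vβ : ThetaSetting.ValuationHatData Dβ Eβ) : Prop :=
  Vα.unitsHat.map δ.toMonoidHom = Vβ.unitsHat ∧
    ∀ ϖ : (↥Dα.Kdd)ˣ, ThetaSetting.IsUniformizer Dα ϖ →
      ∃ ϖ' : (↥Dβ.Kdd)ˣ, ThetaSetting.IsUniformizer Dβ ϖ' ∧
        δ (Eα.toKddHat ϖ) * (Eβ.toKddHat ϖ')⁻¹ ∈ Vβ.unitsHat

/-- **L11, assembly.** abc-iut-L2-t1's `Thm16ii γ h Eα Eβ Vα Vβ` follows from a theta companion, the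
image statement `TransportPreservesFdd2` (⟸ Prop. 1.5 (ii) + [SemiAnbd] Thm. 6.12) and the valuation
clauses for the induced `δ` (⟸ [AbsAnab] Prop. 1.2.1 (iv)(vi)(vii)) — "The asserted compatibility
then follows from [Mzk14], Theorem 6.12; [Mzk2], Proposition 1.2.1, (iv), (vi), (vii)" (p. 24).
[cite: MochizukiEtTh2009, Thm 1.6 (ii) p.24] -/
theorem thm16ii_of_inputs (c : ThetaSetting.ThetaCompanion γ) (h : ThetaSetting.Thm16i γ)
    (Eα : Dα.KummerData) (Eβ : Dβ.KummerData)
    (Vα : ThetaSetting.ValuationHatData Dα Eα) (Vβ : ThetaSetting.ValuationHatData Dβ Eβ)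
    (hT : TransportPreservesFdd2 c h Eα Eβ)
    (hV : ∀ δ : Eα.KddHat ≃* Eβ.KddHat,
      (∀ a, ThetaSetting.transport c h (Dα.inflTheta Dα.GtpYdd (Eα.kumYdd a)) =
        Dβ.inflTheta Dβ.GtpYdd (Eβ.kumYdd (δ a))) → DeltaPreservesUnitsAndOne δ Vα Vβ) :
    ThetaSetting.Thm16ii γ h Eα Eβ Vα Vβ := by
  obtain ⟨δ, hδ⟩ := exists_delta_of_transportPreservesFdd2 c h Eα Eβ hT
  exact ⟨c, δ, hδ, (hV δ hδ).1, (hV δ hδ).2⟩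

/-! ### Row L14 (filtration half): classes with the same restriction to `Δ_Θ` differ by `F̈¹` -/

/-- **L14, filtration half.** Two classes of `H¹((Π^tp_Ÿ)^Θ, Δ_Θ)` "mapping to log(Θ) in the quotient
F̈⁰/F̈¹" (p. 25) — more generally with equal restriction to `Δ_Θ` — differ by an element of
`F̈¹ = Ker(res_{Δ_Θ})` (abc-iut-L2-t1's `Fdd1`). [cite: MochizukiEtTh2009, Thm 1.6 (iii) p.25] -/
theorem div_mem_Fdd1_of_res_eq {D : ThetaSetting p} (hC : D.Compat)
    {x' y' : D.H1Theta (D.GtpYdd.map D.toTheta)}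
    (hres : ContH1.res (MonoidHom.id D.GtpTheta) D.DeltaTheta
        (hC.deltaTheta_le_DtpYddTheta.trans (Subgroup.map_mono inf_le_left)) x' =
      ContH1.res (MonoidHom.id D.GtpTheta) D.DeltaTheta
        (hC.deltaTheta_le_DtpYddTheta.trans (Subgroup.map_mono inf_le_left)) y') :
    x' * y'⁻¹ ∈ ThetaSetting.Fdd1 hC := by
  have key : ∀ r : D.H1Theta (D.GtpYdd.map D.toTheta) →* D.H1Theta D.DeltaTheta,
      r x' = r y' → x' * y'⁻¹ ∈ r.ker := fun r hr => by
    rw [MonoidHom.mem_ker, map_mul, map_inv, hr, mul_inv_cancel]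
  exact key _ hres

/-- **L14, lift form.** For theta classes `x` of `α`-type and `y` with lifts `x'`, `y'` to
`H¹((Π^tp_Ÿ)^Θ, Δ_Θ)` both restricting to `log(Θ)` (Prop. 1.5 (iii)), the lifts differ by `F̈¹`; the
lifts are unique (abc-iut-L2-t12's `prop15iii_unique`). [cite: MochizukiEtTh2009, Thm 1.6 (iii) p.25] -/
theorem lift_div_mem_Fdd1 {D : ThetaSetting p} (hC : D.Compat)
    {x' y' : D.H1Theta (D.GtpYdd.map D.toTheta)}
    (hx : ContH1.res (MonoidHom.id D.GtpTheta) D.DeltaTheta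
        (hC.deltaTheta_le_DtpYddTheta.trans (Subgroup.map_mono inf_le_left)) x' = D.logTheta)
    (hy : ContH1.res (MonoidHom.id D.GtpTheta) D.DeltaTheta
        (hC.deltaTheta_le_DtpYddTheta.trans (Subgroup.map_mono inf_le_left)) y' = D.logTheta) :
    x' * y'⁻¹ ∈ ThetaSetting.Fdd1 hC :=
  div_mem_Fdd1_of_res_eq hC (hx.trans hy.symm)

/-! ### Row L00(iii): Theorem 1.6 (iii) reduced to its core identity -/

/-- **L00(iii), assembly.** abc-iut-L2-t1's `Thm16iii γ h c Eα Eβ hCβ` ("the isomorphism of cohomology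
groups induced by γ maps the classes `O^×_{K̈α}·η̈^Θ_α` to some `Π^tp_{Xβ}/Π^tp_{Yβ} ≅ Z`-conjugate of
`O^×_{K̈β}·η̈^Θ_β`", p. 24) follows by set algebra in the abelian group `H¹(Π^tp_{Ÿβ}, (Δ_Θ)β)` from
THREE inputs: (1) transport carries the unit Kummer classes `κ(O^×_{K̈α})` onto `κ(O^×_{K̈β})`
(= Thm. 1.6 (ii), clauses (a)+(b) restricted to units); (2) conjugation by `σ` stabilises
`κ(O^×_{K̈β})` (Galois acts on `O^×_{K̈}` — a property of genuine Kummer data); (3) THE CORE IDENTITY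
`transport(η̈^Θ_α) ∈ κ(O^×_{K̈β}) · conj_σ(η̈^Θ_β)` (rows L12–L15: inversion compatibility, Prop. 1.5
(ii)(iii), cusp evaluation via the canonical integral structure, [SemiAnbd] Thm. 6.5 (iii)/Cor. 6.11).
[cite: MochizukiEtTh2009, Thm 1.6 (iii) p.24] -/
theorem thm16iii_of_core (h : ThetaSetting.Thm16i γ) (c : ThetaSetting.ThetaCompanion γ)
    (Eα : Dα.EtaleThetaData) (Eβ : Dβ.EtaleThetaData) (hCβ : Dβ.Compat) (σ : Dβ.PiTemp)
    (hunits : Eα.kumUnitsYdd.map (ThetaSetting.transport c h) = Eβ.kumUnitsYdd)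
    (hconj : haveI := hCβ.GtpYdd_normal
      Eβ.kumUnitsYdd.map (ContH1.conj Dβ.toTheta Dβ.DeltaTheta σ) = Eβ.kumUnitsYdd)
    (heta : haveI := hCβ.GtpYdd_normal
      ∃ u ∈ Eβ.kumUnitsYdd, ThetaSetting.transport c h Eα.etaDd =
        u * ContH1.conj Dβ.toTheta Dβ.DeltaTheta σ Eβ.etaDd) :
    ThetaSetting.Thm16iii γ h c Eα Eβ hCβ := by
  haveI := hCβ.GtpYdd_normal
  obtain ⟨u, hu, hue⟩ := heta
  refine ⟨σ, Set.ext fun y => ⟨?_, ?_⟩⟩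
  · rintro ⟨x, ⟨k, hk, rfl⟩, rfl⟩
    have hk' : ThetaSetting.transport c h k * u ∈ Eβ.kumUnitsYdd := by
      refine Eβ.kumUnitsYdd.mul_mem ?_ hu
      rw [← hunits]
      exact ⟨k, hk, rfl⟩
    rw [← hconj] at hk'
    obtain ⟨k'', hk''mem, hk''eq⟩ := hk'
    refine ⟨k'' * Eβ.etaDd, ⟨k'', hk''mem, rfl⟩, ?_⟩
    rw [map_mul, hk''eq, map_mul, hue, mul_assoc]
  · rintro ⟨x, ⟨k', hk', rfl⟩, rfl⟩
    have hk'σ : ContH1.conj Dβ.toTheta Dβ.DeltaTheta σ k' ∈ Eβ.kumUnitsYdd := by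
      rw [← hconj]
      exact ⟨k', hk', rfl⟩
    have hmem : ContH1.conj Dβ.toTheta Dβ.DeltaTheta σ k' * u⁻¹ ∈
        Eα.kumUnitsYdd.map (ThetaSetting.transport c h) := by
      rw [hunits]
      exact Eβ.kumUnitsYdd.mul_mem hk'σ (Eβ.kumUnitsYdd.inv_mem hu)
    obtain ⟨k₀, hk₀, hk₀eq⟩ := hmem
    refine ⟨k₀ * Eα.etaDd, ⟨k₀, hk₀, rfl⟩, ?_⟩
    have hconjEta : ContH1.conj Dβ.toTheta Dβ.DeltaTheta σ Eβ.etaDd =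
        u⁻¹ * ThetaSetting.transport c h Eα.etaDd := by
      rw [hue, inv_mul_cancel_left]
    rw [map_mul, hk₀eq, map_mul, hconjEta, mul_assoc]

end Thm16Sub

end Literature.AnabelianGeometry.EtaleTheta

end
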